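import Literature.Computability.AlgebraicComplexity.AffineSignDetBounds
import Literature.Computability.AlgebraicComplexity.SkewCircuitFormalDegree
import Literature.Computability.AlgebraicComplexity.ConstantFreeNumerals
import Mathlib.LinearAlgebra.Vandermonde
import Mathlib.Algebra.MvPolynomial.Equiv
import HarnessLib

/-!
# AnyonJets — crux `JetConstantElim` (stmt-ValiantsHypothesis-16737), stub `stub_multiplierRemoval`:
# integral interpolation with a multiplier (route-independent toolkit)

Constant-free (`τ`, Bürgisser 2009) extraction of a `u`-coefficient of a polynomial
`G(u) ∈ ℤ[X][u]` of degree `< m` from its values at the integer nodes `0, …, m-1`, WITHOUT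
DIVISION, at the price of the integer multiplier `det V` (`V = (i^j)` the Vandermonde matrix):

* `det_vandermonde_mul_coeff_eq_sum` — Cramer: `det V · [u^k] G = Σ_i adj(V)_{k,i} · G(i)` over any
  commutative ring; `det_vandermonde_nat_pos` — `det V > 0`;
* `eval_C_optionEquivLeft`, `constantFreeComplexity_aeval_elim_le` — specialising the distinguished
  variable of `ℤ[q, X]` at an integer `c` is `optionEquivLeft`-evaluation and costs `τ(F) + τ(c)`;
* `constantFreeComplexity_C_adjugate_vandermonde_le` — the integer constants `adj(V)_{k,i}` are
  constant-free cheap (`≤ 4(m+1)⁴ + m²(5m+2)`: the constant-free generic determinant circuit on the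
  entries `i'^j`, `0`, `1`);
* `aeval_elim_twoPowPencil` — for the inversion pencil `P_n(q; X) = Σ_σ q^{inv σ} Πᵢ X_{σ i,i}` of
  route AnyonJets: `(2^p P_n)(q := c - 1) = 2^p · G(c)` with `G = P_n(u - 1; X)`; `nodes_le_sq`.

Used by `AnyonJetsJetConstantElimMultiplierRemovalPerEasy.lean` (if `τ(PER) = n^{O(1)}` then every
anyonic jet has a uniformly cheap multiple — the negation side of the stub). Theorem-only file, no
`sorry`, no definitions, no route import. HONEST FRAMING: toolkit lemmas; VP ≠ VNP is NOT proved.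

References: V. Strassen, *Vermeidung von Divisionen*, Crelle 264 (1973); P. Bürgisser,
*Completeness and Reduction in Algebraic Complexity Theory*, Springer 2000, Rem. 2.7; P. Bürgisser,
*On defining integers …*, Comput. Complexity 18 (2009), §2.2.
-/

noncomputable section

-- single-conjunct layout: Sub = Summit, duplicated namespace component intended
set_option linter.dupNamespace false

namespace Summit.ValiantsHypothesis.ValiantsHypothesis.Theorems.AnyonJets.JetConstantElim

open MvPolynomial Literature.Computability.AlgebraicComplexity Finset

/-! ### Integral interpolation: Cramer's rule for the Vandermonde system, no division -/

section Interpolation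

variable {R : Type*} [CommRing R]

/-- **`det V · [u^k] G = Σ_{i<m} adj(V)_{k,i} · G(i)`** for a polynomial `G` of degree `< m` over any
commutative ring and the integer Vandermonde matrix `V = (i^j)_{i,j<m}` — the adjugate identity
`adj(V) · V = det V · 1` applied to the coefficient vector (`V · coeff = values`). [folklore] -/
theorem det_vandermonde_mul_coeff_eq_sum {m : ℕ} (G : Polynomial R) (hG : G.natDegree < m)
    (k : Fin m) :
    ((Matrix.vandermonde (fun i : Fin m => (i : ℤ))).det : R) * G.coeff k =
      ∑ i : Fin m, ((Matrix.vandermonde (fun i : Fin m => (i : ℤ))).adjugate k i : R) *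
        G.eval ((i : ℕ) : R) := by
  set V := Matrix.vandermonde (fun i : Fin m => (i : ℤ)) with hV
  -- `G(i) = Σ_j V_{ij} coeff_j`
  have heval : ∀ i : Fin m, G.eval ((i : ℕ) : R) = ∑ j : Fin m, ((V i j : ℤ) : R) * G.coeff j := by
    intro i
    rw [Polynomial.eval_eq_sum_range' hG, Finset.sum_range]
    refine Finset.sum_congr rfl fun j _ => ?_
    rw [hV, Matrix.vandermonde_apply]
    push_cast
    ring
  -- `Σ_i adj_{ki} V_{ij} = det · δ_{kj}`
  have hAV : ∀ j : Fin m, ∑ i : Fin m, ((V.adjugate k i : ℤ) : R) * ((V i j : ℤ) : R) =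
      if k = j then (V.det : R) else 0 := by
    intro j
    have h := congrFun (congrFun (Matrix.adjugate_mul V) k) j
    rw [Matrix.mul_apply, Matrix.smul_apply, Matrix.one_apply, smul_eq_mul, mul_ite, mul_one,
      mul_zero] at h
    have h' := congrArg (fun z : ℤ => (z : R)) h
    simp only [Int.cast_sum, Int.cast_mul] at h'
    rw [h']
    split_ifs <;> simp
  simp_rw [heval, Finset.mul_sum]
  rw [Finset.sum_comm]
  have : ∀ j : Fin m, ∑ i : Fin m, ((V.adjugate k i : ℤ) : R) * (((V i j : ℤ) : R) * G.coeff j) =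
      (if k = j then (V.det : R) else 0) * G.coeff j := by
    intro j
    rw [← hAV j, Finset.sum_mul]
    refine Finset.sum_congr rfl fun i _ => ?_
    ring
  simp_rw [this]
  simp [Finset.sum_ite_eq]

/-- The integer Vandermonde determinant on the nodes `0, 1, …, m-1` is positive
(`det V = ∏_{i<j} (j - i)`). [folklore] -/
theorem det_vandermonde_nat_pos (m : ℕ) :
    0 < (Matrix.vandermonde (fun i : Fin m => (i : ℤ))).det := by
  rw [Matrix.det_vandermonde]
  refine Finset.prod_pos fun i _ => Finset.prod_pos fun j hj => ?_
  rw [Finset.mem_Ioi] at hj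
  have : (i : ℤ) < (j : ℤ) := by exact_mod_cast hj
  omega

end Interpolation

/-! ### Specialising the coupling: `G(c) = P_n(c - 1; X)` and its constant-free cost -/

section Specialise

variable {S : Type*}

/-- Evaluating `optionEquivLeft g` at a constant `C c` is the substitution `X none ↦ C c`,
`X (some s) ↦ X s` in `g`. [folklore] -/
theorem eval_C_optionEquivLeft (g : MvPolynomial (Option S) ℤ) (c : ℤ) :
    Polynomial.eval (C c : MvPolynomial S ℤ) (optionEquivLeft ℤ S g) =
      aeval (fun o : Option S => o.elim (C c) X) g := by
  induction g using MvPolynomial.induction_on with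
  | C a =>
    rw [optionEquivLeft_C, Polynomial.eval_C, aeval_C, MvPolynomial.algebraMap_eq]
  | add p q hp hq => rw [map_add, Polynomial.eval_add, hp, hq, map_add]
  | mul_X p o hp =>
    cases o with
    | none =>
      rw [map_mul, Polynomial.eval_mul, hp, map_mul, aeval_X, optionEquivLeft_X_none,
        Polynomial.eval_X, Option.elim_none]
    | some s =>
      rw [map_mul, Polynomial.eval_mul, hp, map_mul, aeval_X, optionEquivLeft_X_some,
        Polynomial.eval_C, Option.elim_some]

/-- **Substituting a constant for the coupling costs its `τ`**: `τ(F(q := c; X)) ≤ τ(F) + τ(c)`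
(`constantFreeComplexity_aeval_le`; the `X`-variables are substituted by themselves at cost `0`).
[cite: Burgisser2000, Rem. 2.7] -/
theorem constantFreeComplexity_aeval_elim_le [Fintype S] (F : MvPolynomial (Option S) ℤ) (c : ℤ) :
    constantFreeComplexity (aeval (fun o : Option S => o.elim (C c) X) F) ≤
      constantFreeComplexity F + constantFreeComplexity (C c : MvPolynomial S ℤ) := by
  refine (constantFreeComplexity_aeval_le F _).trans ?_
  rw [Fintype.sum_option]
  simp [constantFreeComplexity_X]

end Specialise

/-! ### Constant-free cost of the integer constants `adj(V)_{k,i}` -/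

section Adjugate

variable {S : Type*}

/-- `τ(C ((-1)^k a)) ≤ τ(C a) + 1`. [folklore] -/
theorem constantFreeComplexity_C_neg_one_pow_mul_le (k : ℕ) (a : ℤ) :
    constantFreeComplexity (C ((-1) ^ k * a) : MvPolynomial S ℤ) ≤
      constantFreeComplexity (C a : MvPolynomial S ℤ) + 1 := by
  rcases Nat.even_or_odd k with hk | hk
  · rw [hk.neg_one_pow, one_mul]; exact Nat.le_succ _
  · rw [hk.neg_one_pow, neg_one_mul, map_neg]; exact constantFreeComplexity_neg_le _

/-- **The adjugate entries of the integer Vandermonde matrix are constant-free cheap**: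
`τ(C adj(V)_{k,i}) ≤ 4(m+1)⁴ + m²(5m + 2)` — `adj(V)_{k,i}` is the determinant of `V` with row `i`
replaced by `e_k` (`Matrix.adjugate_apply`); plug the constants `i'^j` (`τ ≤ 3 log₂ i' + 2(log₂ j
+ 1) ≤ 5m + 2`) and `0/1` into the constant-free circuit of the generic determinant
(`constantFreeComplexity_det_le`, `τ(DET_m) ≤ 4(m+1)⁴`). [cite: Burgisser2000, Rem. 2.7] -/
theorem constantFreeComplexity_C_adjugate_vandermonde_le (m : ℕ) (k i : Fin m) :
    constantFreeComplexity
        (C ((Matrix.vandermonde (fun i : Fin m => (i : ℤ))).adjugate k i) : MvPolynomial S ℤ) ≤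
      4 * (m + 1) ^ 4 + m * m * (5 * m + 2) := by
  set V := Matrix.vandermonde (fun i : Fin m => (i : ℤ)) with hV
  rw [Matrix.adjugate_apply, RingHom.map_det]
  refine (constantFreeComplexity_det_le _).trans ?_
  refine Nat.add_le_add (constantFreeComplexity_detPoly_le m) ?_
  have hentry : ∀ ij : Fin m × Fin m,
      constantFreeComplexity (((C : ℤ →+* MvPolynomial S ℤ).mapMatrix
        (V.updateRow i (Pi.single k 1))) ij.1 ij.2) ≤ 5 * m + 2 := by
    rintro ⟨i', j⟩
    rw [RingHom.mapMatrix_apply, Matrix.map_apply]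
    by_cases hi : i' = i
    · subst hi
      rw [Matrix.updateRow_self]
      by_cases hj : j = k
      · subst hj; simp [constantFreeComplexity_one]
      · rw [Pi.single_eq_of_ne hj, map_zero, constantFreeComplexity_zero]; exact Nat.zero_le _
    · rw [Matrix.updateRow_ne hi, hV, Matrix.vandermonde_apply]
      have hcast : (C (((i' : ℕ) : ℤ) ^ (j : ℕ)) : MvPolynomial S ℤ) = C (((i' : ℕ) : ℤ) ^ (j : ℕ)) := rfl
      refine (constantFreeComplexity_C_natCast_pow_le_log (σ := S) (i' : ℕ) (j : ℕ)).trans ?_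
      have h1 : Nat.log 2 (i' : ℕ) ≤ m := (Nat.log_le_self 2 _).trans (le_of_lt i'.isLt)
      have h2 : Nat.log 2 (j : ℕ) ≤ m := (Nat.log_le_self 2 _).trans (le_of_lt j.isLt)
      omega
  calc ∑ ij : Fin m × Fin m, constantFreeComplexity (((C : ℤ →+* MvPolynomial S ℤ).mapMatrix
          (V.updateRow i (Pi.single k 1))) ij.1 ij.2)
      ≤ ∑ _ij : Fin m × Fin m, (5 * m + 2) := Finset.sum_le_sum fun ij _ => hentry ij
    _ = m * m * (5 * m + 2) := by
        rw [Finset.sum_const, Finset.card_univ, Fintype.card_prod, Fintype.card_fin, smul_eq_mul]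

end Adjugate

/-! ### The jets as integral combinations of specialised pencil multiples -/

section Jets

variable (n : ℕ)

/-- Specialising the `2^p`-multiple of the pencil at the integer coupling `c - 1` gives
`2^p · G(c)` for the shifted pencil `G = P_n(u - 1; X)` read as a polynomial in `u`:
`(2^p P_n)(q := c - 1) = 2^p · eval_{u = c} G`. [folklore] -/
theorem aeval_elim_twoPowPencil (p : ℕ) (c : ℤ) :
    aeval (fun o : Option (Fin n × Fin n) => o.elim (C (c - 1)) X)
        (C ((2 : ℤ) ^ p) * ∑ σ : Equiv.Perm (Fin n),
          (X none : MvPolynomial (Option (Fin n × Fin n)) ℤ) ^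
              (univ.filter (fun q : Fin n × Fin n => q.1 < q.2 ∧ σ q.2 < σ q.1)).card *
            ∏ i : Fin n, X (some (σ i, i))) =
      C ((2 : ℤ) ^ p) * Polynomial.eval (C c : MvPolynomial (Fin n × Fin n) ℤ)
        (optionEquivLeft ℤ (Fin n × Fin n) (∑ σ : Equiv.Perm (Fin n),
          ((X none : MvPolynomial (Option (Fin n × Fin n)) ℤ) - 1) ^
              (univ.filter (fun q : Fin n × Fin n => q.1 < q.2 ∧ σ q.2 < σ q.1)).card *
            ∏ i : Fin n, X (some (σ i, i)))) := by
  rw [map_mul, aeval_C, MvPolynomial.algebraMap_eq, eval_C_optionEquivLeft]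
  refine congrArg (C ((2 : ℤ) ^ p) * ·) ?_
  simp only [map_sum, map_mul, map_pow, map_prod, map_sub, map_one, aeval_X, Option.elim_none,
    Option.elim_some]

/-- `m = C(n,2) + 1 ≤ (n+2)²` and `m + 1 ≤ (n+2)²` for the number of interpolation nodes. [folklore] -/
theorem nodes_le_sq : n * (n - 1) / 2 + 1 + 1 ≤ (n + 2) ^ 2 := by
  have h1 : n * (n - 1) / 2 ≤ n * (n - 1) := Nat.div_le_self _ _
  have h2 : n * (n - 1) ≤ n * n := Nat.mul_le_mul_left _ (Nat.sub_le _ _)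
  nlinarith

end Jets

end Summit.ValiantsHypothesis.ValiantsHypothesis.Theorems.AnyonJets.JetConstantElim

end
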